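import Mathlib
import Summits.NavierStokesRegularity.NavierStokesRegularity.Theorems.FilamentSkeletonRssSelectionBoxRJRungPartnerLipschitz

/-!
# Route `FilamentSkeletonRss` · crux `SelectionBoxRJ` (stmt-NavierStokesRegularity-21220) — rung tools (R2, brick 2a):
# two-size Lipschitz bound for the GRADIENT integrand of the regularised Biot–Savart field

Lane `ns-filament-19175-p1` (g7); helper file `--supports stmt-NavierStokesRegularity-21220`, route-independent.

The derivative of the regularised Biot–Savart field of a filament `X` in the direction `v` is the integral of
`G(T, z; v) = (−3⟪z, v⟫ K₅(z)) • T × z + K₃(z) • T × v` along the filament (`T = X′u`, `z = y − X u`,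
`K₃ = ((‖z‖² + e²)^{3/2})⁻¹`, `K₅ = ((‖z‖² + e²)^{5/2})⁻¹`; tree `biotSavart_fderiv_apply_eq`).  For the `C¹` input `ε₁` of the
R2 zero package one needs this gradient to depend Lipschitz-continuously on the filament; the pointwise half is
`grad_integrand_lipschitz`: for `‖T‖, ‖T′‖ ≤ 1`, `‖T − T′‖ ≤ θ₁`, `‖z − z′‖ ≤ θ₂`, `0 < m ≤ ‖z‖, ‖z′‖`,
`‖G(T, z; v) − G(T′, z′; v)‖ ≤ ‖v‖ (4θ₁/m³ + 24θ₂/m⁴)`, uniformly in the core `e`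
(companion of g6's `rosenhead_integrand_lipschitz`, which is the field-level `θ₁/m² + 4θ₂/m³`).  Auxiliary:
`inv_pow5_sub_mul_le` (`|p⁻⁵ − q⁻⁵| p q ≤ 5|p − q|/m⁴`).

HONEST FRAMING.  Kernel algebra for the rung ladder of a HYPOTHETICAL filament box; nothing here is a claim about Navier–Stokes
regularity or blow-up.
-/

set_option linter.dupNamespace false -- `Theorems.…Theorems`-style path/namespace repetition is the tree convention

noncomputable section

namespace Summit.NavierStokesRegularity.NavierStokesRegularity.Theorems

open Set Function Filter Real
open Literature.Analysis.FluidPDE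
open scoped InnerProductSpace Topology

namespace SelectionBoxRJRung

/-- `|p⁻⁵ − q⁻⁵| p q ≤ 5|p − q|/m⁴` whenever `0 < m ≤ p, q`
(`p⁻⁵ − q⁻⁵ = (q − p)(q⁴ + q³p + q²p² + qp³ + p⁴)/(p⁵q⁵)`). [folklore] -/
theorem inv_pow5_sub_mul_le {m p q : ℝ} (hm : 0 < m) (hmp : m ≤ p) (hmq : m ≤ q) :
    |(p ^ 5)⁻¹ - (q ^ 5)⁻¹| * (p * q) ≤ 5 * |p - q| / m ^ 4 := by
  have hp : 0 < p := hm.trans_le hmp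
  have hq : 0 < q := hm.trans_le hmq
  have hid : (p ^ 5)⁻¹ - (q ^ 5)⁻¹ =
      (q - p) * ((q ^ 4 + q ^ 3 * p + q ^ 2 * p ^ 2 + q * p ^ 3 + p ^ 4) / (p ^ 5 * q ^ 5)) := by
    field_simp
    ring
  rw [hid, abs_mul, abs_of_pos (by positivity : 0 < (q ^ 4 + q ^ 3 * p + q ^ 2 * p ^ 2 + q * p ^ 3 + p ^ 4) /
    (p ^ 5 * q ^ 5)), abs_sub_comm, mul_assoc]
  rw [show 5 * |p - q| / m ^ 4 = |p - q| * (5 / m ^ 4) by ring]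
  refine mul_le_mul_of_nonneg_left ?_ (abs_nonneg _)
  rw [div_mul_eq_mul_div, div_le_div_iff₀ (by positivity) (by positivity)]
  -- `m⁴ (q⁴ + q³p + q²p² + qp³ + p⁴) p q ≤ 5 p⁵ q⁵`: each monomial `m⁴ qⁱ p⁴⁻ⁱ p q ≤ p⁵ q⁵`
  have hm4p : m ^ 4 ≤ p ^ 4 := pow_le_pow_left₀ hm.le hmp 4
  have hm4q : m ^ 4 ≤ q ^ 4 := pow_le_pow_left₀ hm.le hmq 4
  have h1 : m ^ 4 * q ^ 4 ≤ p ^ 4 * q ^ 4 := mul_le_mul_of_nonneg_right hm4p (by positivity)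
  have h2 : m ^ 4 * (q ^ 3 * p) ≤ (p ^ 3 * q) * (q ^ 3 * p) := by
    refine mul_le_mul_of_nonneg_right ?_ (by positivity)
    calc m ^ 4 = m ^ 3 * m := by ring
      _ ≤ p ^ 3 * q := mul_le_mul (pow_le_pow_left₀ hm.le hmp 3) hmq hm.le (by positivity)
  have h3 : m ^ 4 * (q ^ 2 * p ^ 2) ≤ (p ^ 2 * q ^ 2) * (q ^ 2 * p ^ 2) := by
    refine mul_le_mul_of_nonneg_right ?_ (by positivity)
    calc m ^ 4 = m ^ 2 * m ^ 2 := by ring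
      _ ≤ p ^ 2 * q ^ 2 := mul_le_mul (pow_le_pow_left₀ hm.le hmp 2) (pow_le_pow_left₀ hm.le hmq 2)
          (by positivity) (by positivity)
  have h4 : m ^ 4 * (q * p ^ 3) ≤ (p * q ^ 3) * (q * p ^ 3) := by
    refine mul_le_mul_of_nonneg_right ?_ (by positivity)
    calc m ^ 4 = m * m ^ 3 := by ring
      _ ≤ p * q ^ 3 := mul_le_mul hmp (pow_le_pow_left₀ hm.le hmq 3) (by positivity) hp.le
  have h5 : m ^ 4 * p ^ 4 ≤ q ^ 4 * p ^ 4 := mul_le_mul_of_nonneg_right hm4q (by positivity)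
  nlinarith [mul_le_mul_of_nonneg_right h1 (by positivity : (0:ℝ) ≤ p * q),
    mul_le_mul_of_nonneg_right h2 (by positivity : (0:ℝ) ≤ p * q),
    mul_le_mul_of_nonneg_right h3 (by positivity : (0:ℝ) ≤ p * q),
    mul_le_mul_of_nonneg_right h4 (by positivity : (0:ℝ) ≤ p * q),
    mul_le_mul_of_nonneg_right h5 (by positivity : (0:ℝ) ≤ p * q)]

/-- **Two-size pointwise Lipschitz bound for the gradient integrand.**  See the module docstring. [folklore] -/
theorem grad_integrand_lipschitz (e : ℝ) {T T' z z' v : EuclideanSpace ℝ (Fin 3)} {θ₁ θ₂ m : ℝ}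
    (hT : ‖T‖ ≤ 1) (hT' : ‖T'‖ ≤ 1) (hTT : ‖T - T'‖ ≤ θ₁) (hzz : ‖z - z'‖ ≤ θ₂) (hm : 0 < m)
    (hmz : m ≤ ‖z‖) (hmz' : m ≤ ‖z'‖) :
    ‖((-3 * ⟪z, v⟫_ℝ * ((‖z‖ ^ 2 + e ^ 2) ^ (5 / 2 : ℝ))⁻¹) • cross T z +
          ((‖z‖ ^ 2 + e ^ 2) ^ (3 / 2 : ℝ))⁻¹ • cross T v) -
        ((-3 * ⟪z', v⟫_ℝ * ((‖z'‖ ^ 2 + e ^ 2) ^ (5 / 2 : ℝ))⁻¹) • cross T' z' +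
          ((‖z'‖ ^ 2 + e ^ 2) ^ (3 / 2 : ℝ))⁻¹ • cross T' v)‖ ≤
      ‖v‖ * (4 * θ₁ / m ^ 3 + 24 * θ₂ / m ^ 4) := by
  have hz : 0 < ‖z‖ := hm.trans_le hmz
  have hz' : 0 < ‖z'‖ := hm.trans_le hmz'
  have hθ₁ : 0 ≤ θ₁ := (norm_nonneg _).trans hTT
  have hθ₂ : 0 ≤ θ₂ := (norm_nonneg _).trans hzz
  have hv : 0 ≤ ‖v‖ := norm_nonneg _
  set p : ℝ := Real.sqrt (‖z‖ ^ 2 + e ^ 2) with hp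
  set q : ℝ := Real.sqrt (‖z'‖ ^ 2 + e ^ 2) with hq
  have hb : 0 < ‖z‖ ^ 2 + e ^ 2 := by positivity
  have hb' : 0 < ‖z'‖ ^ 2 + e ^ 2 := by positivity
  have h32 : ∀ b : ℝ, 0 < b → b ^ (3 / 2 : ℝ) = Real.sqrt b ^ 3 := by
    intro b hb0
    rw [show (3 / 2 : ℝ) = 1 + 1 / 2 by norm_num, Real.rpow_add hb0, Real.rpow_one, ← Real.sqrt_eq_rpow,
      pow_succ, pow_two, Real.mul_self_sqrt hb0.le]
  have h52 : ∀ b : ℝ, 0 < b → b ^ (5 / 2 : ℝ) = Real.sqrt b ^ 5 := by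
    intro b hb0
    rw [show (5 / 2 : ℝ) = 2 + 1 / 2 by norm_num, Real.rpow_add hb0, ← Real.sqrt_eq_rpow,
      show (2:ℝ) = ((2:ℕ):ℝ) by norm_num, Real.rpow_natCast]
    nth_rewrite 1 [← Real.mul_self_sqrt hb0.le]
    ring
  have hK3p : ((‖z‖ ^ 2 + e ^ 2) ^ (3 / 2 : ℝ))⁻¹ = (p ^ 3)⁻¹ := by rw [h32 _ hb]
  have hK3q : ((‖z'‖ ^ 2 + e ^ 2) ^ (3 / 2 : ℝ))⁻¹ = (q ^ 3)⁻¹ := by rw [h32 _ hb']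
  have hK5p : ((‖z‖ ^ 2 + e ^ 2) ^ (5 / 2 : ℝ))⁻¹ = (p ^ 5)⁻¹ := by rw [h52 _ hb]
  have hK5q : ((‖z'‖ ^ 2 + e ^ 2) ^ (5 / 2 : ℝ))⁻¹ = (q ^ 5)⁻¹ := by rw [h52 _ hb']
  have hzp : ‖z‖ ≤ p := by rw [hp]; exact Real.le_sqrt_of_sq_le (le_add_of_nonneg_right (sq_nonneg e))
  have hzq : ‖z'‖ ≤ q := by rw [hq]; exact Real.le_sqrt_of_sq_le (le_add_of_nonneg_right (sq_nonneg e))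
  have hmp : m ≤ p := hmz.trans hzp
  have hmq : m ≤ q := hmz'.trans hzq
  have hppos : 0 < p := hm.trans_le hmp
  have hqpos : 0 < q := hm.trans_le hmq
  have hpq : |p - q| ≤ θ₂ := by
    calc |p - q| ≤ |‖z‖ - ‖z'‖| := norm_sqrt_sq_add_sub_le ‖z‖ ‖z'‖ e
      _ ≤ ‖z - z'‖ := abs_norm_sub_norm_le z z'
      _ ≤ θ₂ := hzz
  rw [hK3p, hK3q, hK5p, hK5q]
  -- cross-product sizes
  have hc1 : ∀ S w : EuclideanSpace ℝ (Fin 3), ‖S‖ ≤ 1 → ‖cross S w‖ ≤ ‖w‖ := fun S w hS => by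
    calc ‖cross S w‖ ≤ ‖S‖ * ‖w‖ := norm_cross_le_norm_mul_norm S w
      _ ≤ 1 * ‖w‖ := mul_le_mul_of_nonneg_right hS (norm_nonneg _)
      _ = ‖w‖ := one_mul _
  have hsubT : ∀ w : EuclideanSpace ℝ (Fin 3), cross T w - cross T' w = cross (T - T') w := fun w => by
    have := map_sub crossCLM T T'
    exact (congrArg (fun L : EuclideanSpace ℝ (Fin 3) →L[ℝ] EuclideanSpace ℝ (Fin 3) => L w) this).symm
  have hsubz : ∀ S : EuclideanSpace ℝ (Fin 3), cross S z - cross S z' = cross S (z - z') := fun S =>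
    (map_sub (crossCLM S) z z').symm
  /- second bracket: `K₃(z) T×v − K₃(z′) T′×v` -/
  have hB2 : ‖(p ^ 3)⁻¹ • cross T v - (q ^ 3)⁻¹ • cross T' v‖ ≤ ‖v‖ * (θ₁ / m ^ 3 + 3 * θ₂ / m ^ 4) := by
    have hdec : (p ^ 3)⁻¹ • cross T v - (q ^ 3)⁻¹ • cross T' v =
        (p ^ 3)⁻¹ • cross (T - T') v + ((p ^ 3)⁻¹ - (q ^ 3)⁻¹) • cross T' v := by
      rw [← hsubT, smul_sub, sub_smul]; abel
    rw [hdec]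
    have h1 : ‖(p ^ 3)⁻¹ • cross (T - T') v‖ ≤ ‖v‖ * (θ₁ / m ^ 3) := by
      rw [norm_smul, Real.norm_of_nonneg (by positivity : (0:ℝ) ≤ (p ^ 3)⁻¹)]
      have : ‖cross (T - T') v‖ ≤ θ₁ * ‖v‖ :=
        (norm_cross_le_norm_mul_norm _ _).trans (mul_le_mul_of_nonneg_right hTT hv)
      calc (p ^ 3)⁻¹ * ‖cross (T - T') v‖ ≤ (m ^ 3)⁻¹ * (θ₁ * ‖v‖) :=
            mul_le_mul (inv_anti₀ (pow_pos hm 3) (pow_le_pow_left₀ hm.le hmp 3)) this (norm_nonneg _) (by positivity)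
        _ = ‖v‖ * (θ₁ / m ^ 3) := by ring
    have h2 : ‖((p ^ 3)⁻¹ - (q ^ 3)⁻¹) • cross T' v‖ ≤ ‖v‖ * (3 * θ₂ / m ^ 4) := by
      rw [norm_smul, Real.norm_eq_abs]
      have hk := inv_cube_sub_mul_le hm hmp hmq
      -- `|p⁻³ − q⁻³| ≤ 3|p−q|/(m³ q) ≤ 3θ₂/m⁴`
      have hk' : |(p ^ 3)⁻¹ - (q ^ 3)⁻¹| ≤ 3 * θ₂ / m ^ 4 := by
        have h := (le_div_iff₀ hqpos).2 hk
        calc |(p ^ 3)⁻¹ - (q ^ 3)⁻¹| ≤ 3 * |p - q| / m ^ 3 / q := h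
          _ ≤ 3 * θ₂ / m ^ 3 / m := by
              rw [div_le_div_iff₀ hqpos hm]
              have : 3 * |p - q| / m ^ 3 ≤ 3 * θ₂ / m ^ 3 := by gcongr
              nlinarith [this, div_nonneg (by positivity : (0:ℝ) ≤ 3 * θ₂) (pow_pos hm 3).le]
          _ = 3 * θ₂ / m ^ 4 := by field_simp
      calc |(p ^ 3)⁻¹ - (q ^ 3)⁻¹| * ‖cross T' v‖ ≤ (3 * θ₂ / m ^ 4) * ‖v‖ :=
            mul_le_mul hk' (hc1 T' v hT') (norm_nonneg _) (by positivity)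
        _ = ‖v‖ * (3 * θ₂ / m ^ 4) := by ring
    calc _ ≤ ‖v‖ * (θ₁ / m ^ 3) + ‖v‖ * (3 * θ₂ / m ^ 4) := norm_add_le_of_le h1 h2
      _ = ‖v‖ * (θ₁ / m ^ 3 + 3 * θ₂ / m ^ 4) := by ring
  /- first bracket: `⟪z,v⟫K₅(z) T×z − ⟪z′,v⟫K₅(z′) T′×z′` -/
  have hB1 : ‖(-3 * ⟪z, v⟫_ℝ * (p ^ 5)⁻¹) • cross T z - (-3 * ⟪z', v⟫_ℝ * (q ^ 5)⁻¹) • cross T' z'‖ ≤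
      ‖v‖ * (3 * θ₁ / m ^ 3 + 21 * θ₂ / m ^ 4) := by
    have ha : |⟪z, v⟫_ℝ - ⟪z', v⟫_ℝ| ≤ θ₂ * ‖v‖ := by
      rw [← inner_sub_left]
      exact (abs_real_inner_le_norm _ _).trans (mul_le_mul_of_nonneg_right hzz hv)
    have ha' : |⟪z', v⟫_ℝ| ≤ q * ‖v‖ := (abs_real_inner_le_norm _ _).trans (mul_le_mul_of_nonneg_right hzq hv)
    -- decomposition into four pieces (linear combination of `T × z`, `T′ × z′`, `T × z′`)
    have hdec : (-3 * ⟪z, v⟫_ℝ * (p ^ 5)⁻¹) • cross T z - (-3 * ⟪z', v⟫_ℝ * (q ^ 5)⁻¹) • cross T' z' =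
        (-3 * ((⟪z, v⟫_ℝ - ⟪z', v⟫_ℝ) * (p ^ 5)⁻¹)) • cross T z +
          (-3 * (⟪z', v⟫_ℝ * ((p ^ 5)⁻¹ - (q ^ 5)⁻¹))) • cross T z +
          (-3 * (⟪z', v⟫_ℝ * (q ^ 5)⁻¹)) • (cross (T - T') z' + cross T (z - z')) := by
      rw [← hsubT z', ← hsubz T]
      module
    rw [hdec]
    have hzp5 : ‖z‖ * m ^ 4 ≤ p ^ 5 := by
      calc ‖z‖ * m ^ 4 ≤ p * p ^ 4 := mul_le_mul hzp (pow_le_pow_left₀ hm.le hmp 4) (by positivity) hppos.le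
        _ = p ^ 5 := by ring
    have h1 : ‖(-3 * ((⟪z, v⟫_ℝ - ⟪z', v⟫_ℝ) * (p ^ 5)⁻¹)) • cross T z‖ ≤ ‖v‖ * (3 * θ₂ / m ^ 4) := by
      rw [norm_smul, Real.norm_eq_abs, abs_mul, abs_mul, show |(-3:ℝ)| = 3 by norm_num,
        abs_of_pos (by positivity : (0:ℝ) < (p ^ 5)⁻¹)]
      have hcz : ‖cross T z‖ ≤ ‖z‖ := hc1 T z hT
      calc 3 * (|⟪z, v⟫_ℝ - ⟪z', v⟫_ℝ| * (p ^ 5)⁻¹) * ‖cross T z‖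
          ≤ 3 * ((θ₂ * ‖v‖) * (p ^ 5)⁻¹) * ‖z‖ :=
            mul_le_mul (mul_le_mul_of_nonneg_left (mul_le_mul_of_nonneg_right ha (by positivity)) (by norm_num))
              hcz (norm_nonneg _) (by positivity)
        _ = 3 * θ₂ * ‖v‖ * (‖z‖ / p ^ 5) := by ring
        _ ≤ 3 * θ₂ * ‖v‖ * (1 / m ^ 4) := by
            refine mul_le_mul_of_nonneg_left ?_ (by positivity)
            rw [div_le_div_iff₀ (by positivity) (by positivity)]; linarith [hzp5]
        _ = ‖v‖ * (3 * θ₂ / m ^ 4) := by ring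
    have h2 : ‖(-3 * (⟪z', v⟫_ℝ * ((p ^ 5)⁻¹ - (q ^ 5)⁻¹))) • cross T z‖ ≤ ‖v‖ * (15 * θ₂ / m ^ 4) := by
      rw [norm_smul, Real.norm_eq_abs, abs_mul, abs_mul, show |(-3:ℝ)| = 3 by norm_num]
      have hk := inv_pow5_sub_mul_le hm hmp hmq
      have hcz : ‖cross T z‖ ≤ p := (hc1 T z hT).trans hzp
      calc 3 * (|⟪z', v⟫_ℝ| * |(p ^ 5)⁻¹ - (q ^ 5)⁻¹|) * ‖cross T z‖
          ≤ 3 * ((q * ‖v‖) * |(p ^ 5)⁻¹ - (q ^ 5)⁻¹|) * p :=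
            mul_le_mul (mul_le_mul_of_nonneg_left (mul_le_mul_of_nonneg_right ha' (abs_nonneg _)) (by norm_num))
              hcz (norm_nonneg _) (by positivity)
        _ = 3 * ‖v‖ * (|(p ^ 5)⁻¹ - (q ^ 5)⁻¹| * (p * q)) := by ring
        _ ≤ 3 * ‖v‖ * (5 * |p - q| / m ^ 4) := mul_le_mul_of_nonneg_left hk (by positivity)
        _ ≤ 3 * ‖v‖ * (5 * θ₂ / m ^ 4) := by gcongr
        _ = ‖v‖ * (15 * θ₂ / m ^ 4) := by ring
    have h3 : ‖(-3 * (⟪z', v⟫_ℝ * (q ^ 5)⁻¹)) • (cross (T - T') z' + cross T (z - z'))‖ ≤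
        ‖v‖ * (3 * θ₁ / m ^ 3 + 3 * θ₂ / m ^ 4) := by
      rw [norm_smul, Real.norm_eq_abs, abs_mul, abs_mul, show |(-3:ℝ)| = 3 by norm_num,
        abs_of_pos (by positivity : (0:ℝ) < (q ^ 5)⁻¹)]
      have hsum : ‖cross (T - T') z' + cross T (z - z')‖ ≤ θ₁ * q + θ₂ := by
        refine norm_add_le_of_le ?_ ?_
        · exact (norm_cross_le_norm_mul_norm _ _).trans
            ((mul_le_mul_of_nonneg_right hTT (norm_nonneg _)).trans (mul_le_mul_of_nonneg_left hzq hθ₁))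
        · exact (hc1 T _ hT).trans hzz
      have hq3 : m ^ 3 ≤ q ^ 3 := pow_le_pow_left₀ hm.le hmq 3
      have hq4 : m ^ 4 ≤ q ^ 4 := pow_le_pow_left₀ hm.le hmq 4
      calc 3 * (|⟪z', v⟫_ℝ| * (q ^ 5)⁻¹) * ‖cross (T - T') z' + cross T (z - z')‖
          ≤ 3 * ((q * ‖v‖) * (q ^ 5)⁻¹) * (θ₁ * q + θ₂) :=
            mul_le_mul (mul_le_mul_of_nonneg_left (mul_le_mul_of_nonneg_right ha' (by positivity)) (by norm_num))
              hsum (norm_nonneg _) (by positivity)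
        _ = 3 * ‖v‖ * (θ₁ / q ^ 3 + θ₂ / q ^ 4) := by field_simp
        _ ≤ 3 * ‖v‖ * (θ₁ / m ^ 3 + θ₂ / m ^ 4) := by
            refine mul_le_mul_of_nonneg_left (add_le_add ?_ ?_) (by positivity)
            · exact div_le_div_of_nonneg_left hθ₁ (pow_pos hm 3) hq3
            · exact div_le_div_of_nonneg_left hθ₂ (pow_pos hm 4) hq4
        _ = ‖v‖ * (3 * θ₁ / m ^ 3 + 3 * θ₂ / m ^ 4) := by ring
    calc _ ≤ ‖v‖ * (3 * θ₂ / m ^ 4) + ‖v‖ * (15 * θ₂ / m ^ 4) + ‖v‖ * (3 * θ₁ / m ^ 3 + 3 * θ₂ / m ^ 4) :=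
          norm_add₃_le.trans (add_le_add (add_le_add h1 h2) h3)
      _ = ‖v‖ * (3 * θ₁ / m ^ 3 + 21 * θ₂ / m ^ 4) := by ring
  -- combine
  have hsplit : ((-3 * ⟪z, v⟫_ℝ * (p ^ 5)⁻¹) • cross T z + (p ^ 3)⁻¹ • cross T v) -
      ((-3 * ⟪z', v⟫_ℝ * (q ^ 5)⁻¹) • cross T' z' + (q ^ 3)⁻¹ • cross T' v) =
      ((-3 * ⟪z, v⟫_ℝ * (p ^ 5)⁻¹) • cross T z - (-3 * ⟪z', v⟫_ℝ * (q ^ 5)⁻¹) • cross T' z') +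
        ((p ^ 3)⁻¹ • cross T v - (q ^ 3)⁻¹ • cross T' v) := by abel
  rw [hsplit]
  calc _ ≤ ‖v‖ * (3 * θ₁ / m ^ 3 + 21 * θ₂ / m ^ 4) + ‖v‖ * (θ₁ / m ^ 3 + 3 * θ₂ / m ^ 4) :=
        norm_add_le_of_le hB1 hB2
    _ = ‖v‖ * (4 * θ₁ / m ^ 3 + 24 * θ₂ / m ^ 4) := by ring

end SelectionBoxRJRung

end Summit.NavierStokesRegularity.NavierStokesRegularity.Theorems
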